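import Mathlib.ModelTheory.Algebra.Field.Basic
import Mathlib.ModelTheory.Algebra.Field.CharP
import Mathlib.ModelTheory.Algebra.Ring.FreeCommRing
import Mathlib.FieldTheory.Perfect
import Mathlib.ModelTheory.Satisfiability
import Mathlib.SetTheory.Cardinal.Finite
import Mathlib.Algebra.Field.ZMod
import Mathlib.Data.Nat.Prime.Infinite
import HarnessLib

/-!
# The theory of finite fields, pseudo-finite fields, and transfer to large finite fields

Z. Chatzidakis, L. van den Dries, A. Macintyre, *Definable sets over finite fields*, J. reine
angew. Math. **427** (1992) 107–135 (bib key ChatzidakisVanDenDriesMacintyre1992), p. 110: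

* "The *theory of finite fields* is the set of all sentences true in all finite fields."
  (Notations and conventions) — `finiteFieldTheory`;
* "Let Psf be the theory of pseudo-finite fields: its models are the infinite fields satisfying
  the sentences that are true in all finite fields." — `pseudoFiniteTheory`
  (`= finiteFieldTheory ∪ Language.ring.infiniteTheory`; models characterised in
  `model_pseudoFiniteTheory_iff`; non-vacuity `isSatisfiable_pseudoFiniteTheory`: pseudo-finite
  fields exist, by compactness from the prime fields `ℤ/pℤ`). (The algebraic description —
  perfect PAC fields with exactly one extension of each degree, CDM (2.5), Ax 1968 — is a theorem
  about these models and is not used here.)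

## Main result: transfer from pseudo-finite fields to all sufficiently large finite fields

`FiniteField.eventually_realize_of_pseudoFinite`: **a ring sentence true in every pseudo-finite
field is true in every sufficiently large finite field** — if every infinite field `K` with
`K ⊨ finiteFieldTheory` satisfies `σ`, then there is `q₀` such that every finite field `F` with
`|F| ≥ q₀` satisfies `σ`. This is the "pure logic" in CDM's Proposition (2.7) ("Such an
equivalence also holds for all sufficiently large enriched finite fields. […] the second part
follows from it by pure logic") and the source of the threshold `q₀` in the Main Theorem: by the
compactness theorem, if finite fields of unbounded size falsified `σ`, then
`finiteFieldTheory ∪ infiniteTheory ∪ {¬σ}` would be finitely satisfiable, hence would have a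
model, i.e. a pseudo-finite field falsifying `σ`. The form for equivalences of formulas with free
variables (and so for formulas of the enriched language `L(c)`, whose constants are variables
subject to a first-order condition) is `FiniteField.eventually_realize_iff_of_pseudoFinite`.
[cite: ChatzidakisVanDenDriesMacintyre1992, (2.7) and p. 110]

All finite fields are taken in `Type` (every finite field is isomorphic to one in `Type`), with
the `Language.ring`-structure `FirstOrder.Ring.compatibleRingOfRing`; pseudo-finite fields are
presented as `[Field K] [CompatibleRing K] [Infinite K]` with `K ⊨ finiteFieldTheory`, the form in
which algebra applies to them (a model of `pseudoFiniteTheory` in the bare structure sense is made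
into such a field by Mathlib's `FirstOrder.Field.fieldOfModelField`).

A first algebraic consequence, of the kind the transfer is combined with in §2:
`FiniteField.perfectField_of_model_finiteFieldTheory` — every field satisfying the theory of
finite fields (in particular every pseudo-finite field) is perfect (CDM (2.1), (2.5)), via the
sentences `pthPowersSentence p` ("`p = 0 →` every element is a `p`-th power"), which are true in
all finite fields (`pthPowersSentence_mem_finiteFieldTheory`).

## References

* [ChatzidakisVanDenDriesMacintyre1992] Z. Chatzidakis, L. van den Dries, A. Macintyre, Definable
  sets over finite fields, J. reine angew. Math. 427 (1992) 107–135, p. 110, (2.1), (2.5) and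
  Prop. (2.7).
* [Ax1968] J. Ax, The elementary theory of finite fields, Ann. of Math. 88 (1968) 239–271.
-/

namespace Literature.ModelTheory.PseudofiniteFields

open FirstOrder FirstOrder.Language FirstOrder.Ring FirstOrder.Field
open scoped FirstOrder Cardinal

/-- **The theory of finite fields**: the set of all sentences of the language of rings that are
true in all finite fields (finite fields in `Type`, as `Language.ring`-structures through
`compatibleRingOfRing`). [cite: ChatzidakisVanDenDriesMacintyre1992, p. 110] -/
def finiteFieldTheory : Language.ring.Theory :=
  {σ | ∀ (K : Type) [Field K] [Fintype K], (letI := compatibleRingOfRing K; K ⊨ σ)}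

/-- **The theory Psf of pseudo-finite fields**: its models are the infinite models of the theory
of finite fields. [cite: ChatzidakisVanDenDriesMacintyre1992, p. 110] -/
def pseudoFiniteTheory : Language.ring.Theory :=
  finiteFieldTheory ∪ Language.ring.infiniteTheory

/-- Unfolding lemma for membership in the theory of finite fields. [folklore] -/
theorem mem_finiteFieldTheory_iff {σ : Language.ring.Sentence} :
    σ ∈ finiteFieldTheory ↔
      ∀ (K : Type) [Field K] [Fintype K], (letI := compatibleRingOfRing K; K ⊨ σ) :=
  Iff.rfl

/-- Every finite field is a model of the theory of finite fields. [folklore] -/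
theorem model_finiteFieldTheory (K : Type) [Field K] [Fintype K] :
    (letI := compatibleRingOfRing K; K ⊨ finiteFieldTheory) := by
  letI := compatibleRingOfRing K
  exact ⟨fun σ hσ => hσ K⟩

/-- The field axioms belong to the theory of finite fields. [folklore] -/
theorem field_subset_finiteFieldTheory :
    FirstOrder.Language.Theory.field ⊆ finiteFieldTheory := by
  intro σ hσ K _ _
  letI := compatibleRingOfRing K
  exact Theory.realize_sentence_of_mem Theory.field hσ

/-- The models of `Psf` are exactly the infinite models of the theory of finite fields.
[cite: ChatzidakisVanDenDriesMacintyre1992, p. 110] -/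
theorem model_pseudoFiniteTheory_iff (K : Type*) [Language.ring.Structure K] :
    K ⊨ pseudoFiniteTheory ↔ K ⊨ finiteFieldTheory ∧ Infinite K := by
  rw [pseudoFiniteTheory, Theory.model_union_iff, model_infiniteTheory_iff]

/-- A sentence with all variables of a formula universally quantified: `closure φ` holds in `M`
iff `φ` holds at every valuation. (Mathlib's `Formula.iAlls` after moving the variables to the
right summand.) [folklore] -/
theorem realize_iAlls_relabel_inr_iff {α : Type} [Finite α] (φ : Language.ring.Formula α)
    (M : Type*) [Language.ring.Structure M] [Nonempty M] :
    M ⊨ ((φ.relabel (Sum.inr : α → Empty ⊕ α)).iAlls α) ↔ ∀ v : α → M, φ.Realize v := by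
  rw [Sentence.Realize, Formula.realize_iAlls]
  refine forall_congr' fun v => ?_
  rw [Formula.realize_relabel]
  exact Iff.of_eq (congrArg φ.Realize (funext fun a => rfl))

/-- **Pseudo-finite fields exist**: `Psf` is satisfiable. Every finite fragment of
`finiteFieldTheory ∪ infiniteTheory` holds in the prime field `ℤ/pℤ` for a prime `p` exceeding
the cardinality axioms of the fragment (there are infinitely many primes), so the compactness
theorem gives a model. (Equivalently: a non-principal ultraproduct of finite fields of unbounded
size is pseudo-finite.) [folklore] [cite: ChatzidakisVanDenDriesMacintyre1992, p. 110] -/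
theorem isSatisfiable_pseudoFiniteTheory : pseudoFiniteTheory.IsSatisfiable := by
  classical
  refine Theory.isSatisfiable_iff_isFinitelySatisfiable.2 fun T0 hT0 => ?_
  -- a bound for the cardinality axioms occurring in `T0`
  have hcard : ∀ τ : Language.ring.Sentence, ∃ n : ℕ,
      τ ∈ Language.ring.infiniteTheory → τ = Sentence.cardGe Language.ring n := by
    intro τ
    by_cases hτ : τ ∈ Language.ring.infiniteTheory
    · obtain ⟨n, rfl⟩ := Set.mem_range.1 hτ
      exact ⟨n, fun _ => rfl⟩
    · exact ⟨0, fun h => (hτ h).elim⟩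
  choose nOf hnOf using hcard
  -- a prime `p ≥ sup nOf`, and the finite field `ℤ/pℤ`
  obtain ⟨p, hp, hprime⟩ := Nat.exists_infinite_primes (T0.sup nOf)
  haveI : Fact p.Prime := ⟨hprime⟩
  letI := compatibleRingOfRing (ZMod p)
  have hF : ZMod p ⊨ (T0 : Language.ring.Theory) := by
    refine ⟨fun τ hτ => ?_⟩
    rcases (Set.mem_union _ _ _).1 (hT0 hτ) with hτ1 | hτ2
    · exact hτ1 (ZMod p)
    · rw [hnOf τ hτ2, Sentence.realize_cardGe, Cardinal.mk_fintype, Nat.cast_le, ZMod.card]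
      exact (Finset.le_sup (f := nOf) (Finset.mem_coe.1 hτ)).trans hp
  exact Theory.Model.isSatisfiable (ZMod p)

namespace FiniteField

/-- **Transfer from pseudo-finite fields to large finite fields (compactness).** If a sentence
`σ` of the language of rings holds in every pseudo-finite field — every infinite field
satisfying all sentences true in all finite fields — then there is `q₀` such that `σ` holds in
every finite field with at least `q₀` elements. Proof: otherwise finite fields of unbounded size
falsify `σ`, so every finite part of `finiteFieldTheory ∪ infiniteTheory ∪ {¬σ}` has a finite
field as a model; by the compactness theorem the whole theory has a model, which (made into a
field by `fieldOfModelField`) is a pseudo-finite field falsifying `σ`.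
[cite: ChatzidakisVanDenDriesMacintyre1992, (2.7) ("by pure logic") and p. 110] -/
theorem eventually_realize_of_pseudoFinite (σ : Language.ring.Sentence)
    (h : ∀ (K : Type) [Field K] [CompatibleRing K] [Infinite K], K ⊨ finiteFieldTheory → K ⊨ σ) :
    ∃ q₀ : ℕ, ∀ (F : Type) [Field F] [Fintype F], q₀ ≤ Fintype.card F →
      (letI := compatibleRingOfRing F; F ⊨ σ) := by
  classical
  by_contra hcon
  push Not at hcon
  -- `hcon : ∀ q₀, ∃ F, finite field, q₀ ≤ |F| ∧ ¬ F ⊨ σ`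
  set T : Language.ring.Theory := finiteFieldTheory ∪ Language.ring.infiniteTheory ∪ {σ.not}
    with hT
  -- every finite fragment of `T` has a finite field as a model
  have hfin : T.IsFinitelySatisfiable := by
    intro T0 hT0
    -- a bound for the cardinality axioms occurring in `T0`
    have hcard : ∀ τ : Language.ring.Sentence, ∃ n : ℕ,
        τ ∈ Language.ring.infiniteTheory → τ = Sentence.cardGe Language.ring n := by
      intro τ
      by_cases hτ : τ ∈ Language.ring.infiniteTheory
      · obtain ⟨n, rfl⟩ := Set.mem_range.1 hτ
        exact ⟨n, fun _ => rfl⟩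
      · exact ⟨0, fun h => (hτ h).elim⟩
    choose nOf hnOf using hcard
    obtain ⟨F, _, _, hqF, hFσ⟩ := hcon (T0.sup nOf)
    letI := compatibleRingOfRing F
    have hF : F ⊨ (T0 : Language.ring.Theory) := by
      refine ⟨fun τ hτ => ?_⟩
      have hτT := hT0 hτ
      simp only [hT, Set.mem_union, Set.mem_singleton_iff] at hτT
      rcases hτT with (hτ1 | hτ2) | hτ3
      · exact hτ1 F
      · rw [hnOf τ hτ2, Sentence.realize_cardGe, Cardinal.mk_fintype, Nat.cast_le]
        exact (Finset.le_sup (f := nOf) (Finset.mem_coe.1 hτ)).trans hqF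
      · subst hτ3
        exact (Sentence.realize_not (M := F)).2 hFσ
    exact Theory.Model.isSatisfiable F
  -- hence `T` has a model: a pseudo-finite field falsifying `σ`
  obtain ⟨M⟩ := Theory.isSatisfiable_iff_isFinitelySatisfiable.2 hfin
  have hMT : (M : Type) ⊨ T := M.is_model
  have hM1 : (M : Type) ⊨ finiteFieldTheory :=
    hMT.mono (Set.subset_union_left.trans Set.subset_union_left)
  have hM2 : (M : Type) ⊨ Language.ring.infiniteTheory :=
    hMT.mono (Set.subset_union_right.trans Set.subset_union_left)
  have hM3 : (M : Type) ⊨ σ.not :=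
    hMT.realize_of_mem _ (Set.mem_union_right _ (Set.mem_singleton _))
  haveI : (M : Type) ⊨ FirstOrder.Language.Theory.field :=
    hM1.mono field_subset_finiteFieldTheory
  haveI : Infinite M := (model_infiniteTheory_iff Language.ring).1 hM2
  letI : Field M := fieldOfModelField M
  letI : CompatibleRing M := compatibleRingOfModelField M
  exact (Sentence.realize_not (M := M)).1 hM3 (h M hM1)

/-- **Transfer of equivalences (and other uniform statements with free variables).** If two ring
formulas `φ(v)`, `ψ(v)` in finitely many free variables are equivalent in every pseudo-finite
field, then they are equivalent in every sufficiently large finite field. Applied with the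
enrichment constants of CDM's language `L(c)` among the free variables (they are subject to a
first-order condition), this is the passage from enriched pseudo-finite fields to all
sufficiently large enriched finite fields in Prop. (2.7).
[cite: ChatzidakisVanDenDriesMacintyre1992, (2.7)] -/
theorem eventually_realize_iff_of_pseudoFinite {α : Type} [Finite α]
    (φ ψ : Language.ring.Formula α)
    (h : ∀ (K : Type) [Field K] [CompatibleRing K] [Infinite K], K ⊨ finiteFieldTheory →
      ∀ v : α → K, φ.Realize v ↔ ψ.Realize v) :
    ∃ q₀ : ℕ, ∀ (F : Type) [Field F] [Fintype F], q₀ ≤ Fintype.card F →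
      ∀ v : α → F, (letI := compatibleRingOfRing F; φ.Realize v ↔ ψ.Realize v) := by
  obtain ⟨q₀, hq₀⟩ := eventually_realize_of_pseudoFinite
    (((φ.iff ψ).relabel (Sum.inr : α → Empty ⊕ α)).iAlls α) fun K _ _ _ hK => by
      rw [realize_iAlls_relabel_inr_iff]
      intro v
      exact Formula.realize_iff.2 (h K hK v)
  refine ⟨q₀, fun F _ _ hF v => ?_⟩
  letI := compatibleRingOfRing F
  have := (realize_iAlls_relabel_inr_iff (φ.iff ψ) F).1 (hq₀ F hF) v
  exact Formula.realize_iff.1 this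

/-- **Transfer of a uniform property.** If a ring formula `φ(v)` holds identically in every
pseudo-finite field, it holds identically in every sufficiently large finite field.
[cite: ChatzidakisVanDenDriesMacintyre1992, (2.7)] -/
theorem eventually_realize_forall_of_pseudoFinite {α : Type} [Finite α]
    (φ : Language.ring.Formula α)
    (h : ∀ (K : Type) [Field K] [CompatibleRing K] [Infinite K], K ⊨ finiteFieldTheory →
      ∀ v : α → K, φ.Realize v) :
    ∃ q₀ : ℕ, ∀ (F : Type) [Field F] [Fintype F], q₀ ≤ Fintype.card F →
      ∀ v : α → F, (letI := compatibleRingOfRing F; φ.Realize v) := by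
  obtain ⟨q₀, hq₀⟩ := eventually_realize_of_pseudoFinite
    ((φ.relabel (Sum.inr : α → Empty ⊕ α)).iAlls α) fun K _ _ _ hK => by
      rw [realize_iAlls_relabel_inr_iff]
      exact h K hK
  refine ⟨q₀, fun F _ _ hF v => ?_⟩
  letI := compatibleRingOfRing F
  exact (realize_iAlls_relabel_inr_iff φ F).1 (hq₀ F hF) v

end FiniteField

/-! ### A first algebraic consequence: pseudo-finite fields are perfect (CDM (2.1), (2.5)) -/

/-- The sentence "`p = 0 →` every element is a `p`-th power" of the language of rings
(`∀ x ∃ y, y^p = x` under the hypothesis that the characteristic divides `p`).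
[cite: ChatzidakisVanDenDriesMacintyre1992, (2.1)] -/
noncomputable def pthPowersSentence (p : ℕ) : Language.ring.Sentence :=
  (eqZero p).imp
    (Formula.iAlls (Fin 1) (Formula.iExs (Fin 1)
      (Term.equal
        (termOfFreeCommRing (FreeCommRing.of (Sum.inr (0 : Fin 1)) ^ p))
        (termOfFreeCommRing (FreeCommRing.of (Sum.inl (Sum.inr (0 : Fin 1))))) :
        Language.ring.Formula ((Empty ⊕ Fin 1) ⊕ Fin 1))))

/-- Semantics of `pthPowersSentence`: `K ⊨ π_p` iff (`p = 0` in `K` implies every element of `K`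
is a `p`-th power). [folklore] -/
theorem realize_pthPowersSentence_iff (K : Type*) [CommRing K] [CompatibleRing K] (p : ℕ) :
    K ⊨ pthPowersSentence p ↔ ((p : K) = 0 → ∀ x : K, ∃ y : K, y ^ p = x) := by
  rw [pthPowersSentence, Sentence.Realize, Formula.realize_imp, realize_eqZero,
    Formula.realize_iAlls]
  refine imp_congr_right fun _ => ?_
  constructor
  · intro h x
    obtain ⟨j, hj⟩ := (Formula.realize_iExs).1 (h fun _ => x)
    refine ⟨j 0, ?_⟩
    simpa [Formula.realize_equal, realize_termOfFreeCommRing] using hj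
  · intro h i
    obtain ⟨y, hy⟩ := h (i 0)
    refine (Formula.realize_iExs).2 ⟨fun _ => y, ?_⟩
    simpa [Formula.realize_equal, realize_termOfFreeCommRing] using hy

/-- In a finite field whose characteristic divides the prime `p`, every element is a `p`-th power
(the Frobenius of a finite field is bijective); so `π_p` belongs to the theory of finite fields.
[folklore] -/
theorem pthPowersSentence_mem_finiteFieldTheory {p : ℕ} (hp : p.Prime) :
    pthPowersSentence p ∈ finiteFieldTheory := by
  intro K _ _
  letI := compatibleRingOfRing K
  rw [realize_pthPowersSentence_iff]
  intro hpK x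
  -- the characteristic of `K` is `p`
  have hchar : CharP K p := by
    have hdvd : ringChar K ∣ p := (ringChar.spec K p).1 hpK
    rcases (Nat.dvd_prime hp).1 hdvd with h1 | h2
    · exact absurd h1 (CharP.ringChar_ne_one)
    · exact (ringChar.eq_iff).1 h2
  haveI := hchar
  haveI : Fact p.Prime := ⟨hp⟩
  haveI : ExpChar K p := ExpChar.prime hp
  exact (frobeniusEquiv K p).surjective x

namespace FiniteField

/-- **Pseudo-finite fields are perfect** (CDM (2.1)/(2.5): "Let `F` be a perfect field …";
pseudo-finite fields are in particular perfect). In characteristic `p > 0` the sentence `π_p`,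
true in all finite fields, makes the Frobenius surjective.
[cite: ChatzidakisVanDenDriesMacintyre1992, (2.5)] -/
theorem perfectField_of_model_finiteFieldTheory (K : Type*) [Field K] [CompatibleRing K]
    (hK : K ⊨ finiteFieldTheory) : PerfectField K := by
  obtain ⟨p, hchar⟩ := CharP.exists K
  rcases CharP.char_is_prime_or_zero K p with hp | rfl
  · haveI : ExpChar K p := ExpChar.prime hp
    have hsurj : Function.Surjective (frobenius K p) := fun x => by
      obtain ⟨y, hy⟩ := (realize_pthPowersSentence_iff K p).1
        (hK.realize_of_mem _ (pthPowersSentence_mem_finiteFieldTheory hp))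
        (CharP.cast_eq_zero K p) x
      exact ⟨y, by simpa [frobenius] using hy⟩
    haveI := PerfectRing.ofSurjective K p hsurj
    exact PerfectRing.toPerfectField K p
  · haveI := CharP.charP_to_charZero K
    exact PerfectField.ofCharZero

end FiniteField

end Literature.ModelTheory.PseudofiniteFields
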